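import Mathlib.Algebra.BigOperators.Ring.Finset
import Mathlib.Algebra.BigOperators.Pi
import Mathlib.Algebra.Order.BigOperators.Ring.Finset
import Mathlib.Data.Real.Basic
import Mathlib.Data.Fintype.Pi
import Mathlib.Data.Nat.Choose.Sum
import Mathlib.Algebra.BigOperators.Fin
import Mathlib.Data.Fin.Tuple.Sort
import HarnessLib

/-!
# `NoHeavyLowerTail` (crux stmt-CriticalPhenomena-4575), abstract sunflower cubic: A REFLECTED BERNSTEIN POSITIVITY CHECKER, I
# (dense integer polynomials: evaluation, products, memoisation)

Support file (seat `prim-ineq-prove-1` gen 38; `--supports stmt-CriticalPhenomena-4575`).  No `sorry`, no named facts.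
Memo: run/shared/lean/prim/prim-ineq-prove-1/FINDING-BERNSTEIN-prove1-g38.md §1, §5.

PURPOSE.  The safety inequalities `∏_k famIn(𝒰_k) ≤ famIn(∅)^(K−1)` of a core are polynomial inequalities in the coordinate
probabilities `p ∈ [0,1]^n`, of degree `≤ K` in each variable.  Such an inequality `0 ≤ D(p)` is CERTIFIED by exhibiting
`D = Σ_j B_j · ∏_i p_i^{j_i} (1 − p_i)^{d − j_i}` with integers `B_j ≥ 0` (the scaled tensor-Bernstein coefficients).  This file is the
first, generic and computable, part of that certificate (part II, …SunflowerBernsteinCertificate, has the Bernstein basis and the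
certificate; …SunflowerBernsteinFamIn the bridge to `famIn`; …SunflowerBernsteinPathFive(Check) / …Pentagon(Check) the first cores):
* `Poly n d` — dense integer polynomials in `n` variables of degree `≤ d` in each variable (a coefficient function on the finite box
  `Expo n d = Fin n → Fin (d+1)`), `eval`, `single`, `mul : Poly n a → Poly n b → Poly n (a+b)` and its single-sum form `mulFast`
  (`mulFast_eq`), with the evaluation lemmas (`eval_add/sub/smul/single/sum`, **`eval_mul`**, `eval_const`);
* `encode`/`decode` (mixed radix, `decode_encode`, `encode_lt`), **`tabulate`** (the coefficient TABLE of a polynomial, an `Array ℤ`)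
  and `ofTable` (`ofTable_tabulate : ofTable n d (tabulate P) = P`) — all computations pass ARRAYS between stages, so every stage is
  evaluated once (closures returned by functions are re-evaluated at each call by the compiled code);
* `prodFinA k v` — the table of the product of `k` multi-affine factors given by their tables (degree `k`), **`eval_prodFinA`**.
-/

namespace Summit.CriticalPhenomena.PercolationContinuityZ3.Theorems.SunflowerPartition

namespace SafeCalc

namespace Bern

open Finset

/-! ## Dense polynomials -/

/-- Exponent vectors of degree `≤ d` in each of `n` variables. [this work] -/
abbrev Expo (n d : ℕ) := Fin n → Fin (d + 1)

/-- Dense integer polynomials in `n` variables of degree `≤ d` in each variable: the coefficient function. [this work] -/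
abbrev Poly (n d : ℕ) := Expo n d → ℤ

variable {n d a b : ℕ}

/-- The monomial `∏_i x_i^{e_i}`. [this work] -/
def mono (e : Expo n d) (x : Fin n → ℝ) : ℝ := ∏ i, x i ^ (e i : ℕ)

/-- Evaluation of a dense polynomial at a real point. [this work] -/
def eval (P : Poly n d) (x : Fin n → ℝ) : ℝ := ∑ e, (P e : ℝ) * mono e x

/-- The polynomial with a single coefficient. [this work] -/
def single (e₀ : Expo n d) (c : ℤ) : Poly n d := fun e => if e = e₀ then c else 0

/-- Sum of exponent vectors. [this work] -/
def addE (e₁ : Expo n a) (e₂ : Expo n b) : Expo n (a + b) := fun i => ⟨(e₁ i : ℕ) + e₂ i, by omega⟩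

/-- Product of dense polynomials (degrees add). [this work] -/
def mul (P : Poly n a) (Q : Poly n b) : Poly n (a + b) :=
  fun e => ∑ e₁ : Expo n a, ∑ e₂ : Expo n b, if addE e₁ e₂ = e then P e₁ * Q e₂ else 0


/-- Fast product: a single sum over the exponents of the SECOND factor (in the applications it is multi-affine, so the sum has
`2^n` terms); the same function as `mul`, see `mulFast_eq`. [this work] -/
def mulFast (P : Poly n a) (Q : Poly n b) : Poly n (a + b) :=
  fun e => ∑ e₂ : Expo n b,
    if h : (∀ i, (e₂ i : ℕ) ≤ (e i : ℕ) ∧ (e i : ℕ) ≤ (e₂ i : ℕ) + a) then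
      P (fun i => ⟨(e i : ℕ) - e₂ i, by have := h i; omega⟩) * Q e₂
    else (0 : ℤ)

/-- `mulFast` computes `mul`. [this work] -/
theorem mulFast_eq (P : Poly n a) (Q : Poly n b) : mulFast P Q = mul P Q := by
  funext e
  unfold mulFast mul
  rw [Finset.sum_comm]
  refine sum_congr rfl fun e₂ _ => ?_
  by_cases h : ∀ i, (e₂ i : ℕ) ≤ (e i : ℕ) ∧ (e i : ℕ) ≤ (e₂ i : ℕ) + a
  · rw [dif_pos h]
    let e₁ : Expo n a := fun i => ⟨(e i : ℕ) - e₂ i, by have := h i; omega⟩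
    have he₁ : addE e₁ e₂ = e := funext fun i => Fin.ext (by have := h i; simp only [addE, e₁]; omega)
    rw [Finset.sum_eq_single e₁]
    · rw [if_pos he₁]
    · intro e₁' _ hne
      rw [if_neg]
      intro heq
      apply hne
      funext i
      have h1 := congrFun heq i
      have h2 := congrFun he₁ i
      simp only [addE, Fin.ext_iff] at h1 h2
      exact Fin.ext (by omega)
    · intro hmem; exact absurd (mem_univ _) hmem
  · rw [dif_neg h]
    refine (sum_eq_zero fun e₁ _ => ?_).symm
    rw [if_neg]
    intro heq
    apply h
    intro i
    have h1 := congrFun heq i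
    simp only [addE, Fin.ext_iff] at h1
    have := (e₁ i).2
    constructor <;> omega

/-- Evaluation is additive. [this work] -/
@[simp] theorem eval_add (P Q : Poly n d) (x : Fin n → ℝ) : eval (P + Q) x = eval P x + eval Q x := by
  simp only [eval, Pi.add_apply, Int.cast_add, add_mul, sum_add_distrib]

/-- Evaluation respects subtraction. [this work] -/
@[simp] theorem eval_sub (P Q : Poly n d) (x : Fin n → ℝ) : eval (P - Q) x = eval P x - eval Q x := by
  simp only [eval, Pi.sub_apply, Int.cast_sub, sub_mul, sum_sub_distrib]

/-- The zero polynomial evaluates to `0`. [this work] -/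
@[simp] theorem eval_zero (x : Fin n → ℝ) : eval (0 : Poly n d) x = 0 := by
  simp [eval]

/-- Evaluation respects integer scaling. [this work] -/
@[simp] theorem eval_smul (c : ℤ) (P : Poly n d) (x : Fin n → ℝ) : eval (c • P) x = c * eval P x := by
  simp only [eval, Pi.smul_apply, smul_eq_mul, Int.cast_mul, mul_assoc, mul_sum]

/-- Evaluation of a single-coefficient polynomial. [this work] -/
@[simp] theorem eval_single (e₀ : Expo n d) (c : ℤ) (x : Fin n → ℝ) : eval (single e₀ c) x = c * mono e₀ x := by
  simp only [eval, single]
  rw [Finset.sum_eq_single e₀]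
  · simp
  · intro e _ hne; simp [hne]
  · intro h; exact absurd (mem_univ _) h

/-- Evaluation of a finite sum of polynomials. [this work] -/
theorem eval_sum {ι : Type*} (s : Finset ι) (f : ι → Poly n d) (x : Fin n → ℝ) :
    eval (∑ i ∈ s, f i) x = ∑ i ∈ s, eval (f i) x := by
  classical
  induction s using Finset.induction_on with
  | empty => simp
  | insert a s ha ih => rw [sum_insert ha, sum_insert ha, eval_add, ih]

/-- Monomials multiply by adding exponents. [this work] -/
theorem mono_addE (e₁ : Expo n a) (e₂ : Expo n b) (x : Fin n → ℝ) :
    mono (addE e₁ e₂) x = mono e₁ x * mono e₂ x := by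
  simp only [mono, addE, pow_add, prod_mul_distrib]

/-- The product polynomial as a double sum of single terms. [this work] -/
theorem mul_eq_sum (P : Poly n a) (Q : Poly n b) :
    mul P Q = ∑ e₁ : Expo n a, ∑ e₂ : Expo n b, single (addE e₁ e₂) (P e₁ * Q e₂) := by
  funext e
  simp only [mul, single, Finset.sum_apply]
  refine sum_congr rfl fun e₁ _ => sum_congr rfl fun e₂ _ => ?_
  by_cases h : addE e₁ e₂ = e
  · rw [if_pos h, if_pos h.symm]
  · rw [if_neg h, if_neg (Ne.symm h)]

/-- **Evaluation is multiplicative.** [this work] -/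
theorem eval_mul (P : Poly n a) (Q : Poly n b) (x : Fin n → ℝ) : eval (mul P Q) x = eval P x * eval Q x := by
  rw [mul_eq_sum, eval_sum]
  simp only [eval_sum, eval_single, Int.cast_mul, mono_addE]
  rw [eval, eval, sum_mul_sum]
  refine sum_congr rfl fun e₁ _ => sum_congr rfl fun e₂ _ => by ring

/-- The constant polynomial (degree `0`). [this work] -/
def const (c : ℤ) : Poly n 0 := fun _ => c

/-- Evaluation of a constant. [this work] -/
@[simp] theorem eval_const (c : ℤ) (x : Fin n → ℝ) : eval (const (n := n) c) x = c := by
  have huniq : ∀ e : Expo n 0, e = fun _ => 0 := fun e => funext fun i => Fin.ext (by have := (e i).2; omega)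
  simp only [eval, const]
  rw [Finset.sum_eq_single (fun _ => (0 : Fin 1))]
  · simp [mono]
  · intro e _ hne; exact absurd (huniq e) hne
  · intro h; exact absurd (mem_univ _) h

/-! ## Tabulation (mixed-radix codes; coefficient tables as arrays) -/

/-- Mixed-radix code of an exponent vector. [this work] -/
def encode : (n : ℕ) → Expo n d → ℕ
  | 0, _ => 0
  | n + 1, e => (e 0 : ℕ) + (d + 1) * encode n (Fin.tail e)

/-- Mixed-radix decoding. [this work] -/
def decode : (n : ℕ) → ℕ → Expo n d
  | 0, _ => fun i => i.elim0
  | n + 1, k => Fin.cons ⟨k % (d + 1), Nat.mod_lt _ (Nat.succ_pos d)⟩ (decode n (k / (d + 1)))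

/-- Decoding the code of an exponent vector gives it back. [this work] -/
theorem decode_encode : ∀ (n : ℕ) (e : Expo n d), decode n (encode n e) = e
  | 0, e => funext fun i => i.elim0
  | n + 1, e => by
    have hD : 0 < d + 1 := Nat.succ_pos d
    have h0 : ((e 0 : ℕ) + (d + 1) * encode n (Fin.tail e)) % (d + 1) = e 0 := by
      rw [Nat.add_mul_mod_self_left, Nat.mod_eq_of_lt (e 0).2]
    have h1 : ((e 0 : ℕ) + (d + 1) * encode n (Fin.tail e)) / (d + 1) = encode n (Fin.tail e) := by
      rw [Nat.add_mul_div_left _ _ hD, Nat.div_eq_of_lt (e 0).2, zero_add]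
    rw [encode, decode, h1, decode_encode n (Fin.tail e)]
    refine funext fun i => ?_
    refine Fin.cases ?_ (fun j => ?_) i
    · simp only [Fin.cons_zero]; exact Fin.ext h0
    · simp only [Fin.cons_succ, Fin.tail]

/-- Codes are below `(d+1)^n`. [this work] -/
theorem encode_lt : ∀ (n : ℕ) (e : Expo n d), encode n e < (d + 1) ^ n
  | 0, _ => by simp [encode]
  | n + 1, e => by
    rw [encode, pow_succ]
    have h0 : (e 0 : ℕ) < d + 1 := (e 0).2
    have h1 := encode_lt n (Fin.tail e)
    calc (e 0 : ℕ) + (d + 1) * encode n (Fin.tail e)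
        < (d + 1) + (d + 1) * encode n (Fin.tail e) := by omega
      _ = (d + 1) * (encode n (Fin.tail e) + 1) := by ring
      _ ≤ (d + 1) * (d + 1) ^ n := Nat.mul_le_mul_left _ h1
      _ = (d + 1) ^ n * (d + 1) := by ring

/-- The coefficient TABLE of a polynomial (an array indexed by codes). [this work] -/
def tabulate (P : Poly n d) : Array ℤ := (Array.range ((d + 1) ^ n)).map fun k => P (decode n k)

/-- The polynomial of a coefficient table. [this work] -/
def ofTable (n d : ℕ) (A : Array ℤ) : Poly n d := fun e => A.getD (encode n e) 0

/-- Tabulating and reading back is the identity. [this work] -/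
theorem ofTable_tabulate (P : Poly n d) : ofTable n d (tabulate P) = P := by
  funext e
  simp only [ofTable, tabulate, Array.getD_eq_getD_getElem?, Array.getElem?_map, Array.getElem?_range, encode_lt,
    if_true, Option.map_some, Option.getD_some, decode_encode]

/-- Product of `k` multi-affine factors given by their TABLES; the result is the table of the product (degree `k`).  Intermediate
results are arrays, so each stage is computed once. [this work] -/
def prodFinA : (k : ℕ) → (Fin k → Array ℤ) → Array ℤ
  | 0, _ => tabulate (const (n := n) 1)
  | k + 1, v => tabulate (mulFast (ofTable n k (prodFinA k fun i => v (Fin.castSucc i))) (ofTable n 1 (v (Fin.last k))))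

/-- **Evaluation of a tabulated product is the product of the evaluations.** [this work] -/
theorem eval_prodFinA : ∀ (k : ℕ) (v : Fin k → Array ℤ) (x : Fin n → ℝ),
    eval (ofTable n k (prodFinA (n := n) k v)) x = ∏ i, eval (ofTable n 1 (v i)) x
  | 0, v, x => by simp [prodFinA, ofTable_tabulate]
  | k + 1, v, x => by
    rw [prodFinA, ofTable_tabulate, mulFast_eq, eval_mul, eval_prodFinA k, Fin.prod_univ_castSucc]

end Bern

end SafeCalc

end Summit.CriticalPhenomena.PercolationContinuityZ3.Theorems.SunflowerPartition
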